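import Summits.QuantumFields.YangMills.Theorems.F4SubCurvatureDoorShortRootRigiditySchwarzReflection
import Summits.QuantumFields.YangMills.Theorems.F4SubCurvatureDoorShortRootRigiditySchwarzReflectionTwo
import Literature.Algebra.Polynomial.LaplacianOrthogonalInvariance
import Mathlib
import HarnessLib

/-!
# Uniqueness on the trigonal plane: a planar-harmonic trace is determined by one line

Core of stub L2 `stub_sectoralSpan` of the sub-skeleton `Cruxes/ShortRootRigidity/Lines/trigonal_injectivity.lean`
(crux ⟨stmt-QuantumFields-23035⟩, stub `:146`; paper proof `Cruxes/ShortRootRigidity/TrigonalInjectivity.md` §1 (1), §1-bis).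

`bind₁_proj_eq_zero`: let `proj` be the projection `q ↦ q − ((q₀+q₁+q₂)/3)(1,1,1)` onto the plane `x₀+x₁+x₂ = 0`.  If `Y∘proj` is
harmonic, `Y` takes the same value at `p` and at `(−p₂, −p₁, −p₀)` for every `p` in the plane, and `Y` vanishes on the line
`ℝ(1,0,−1)`, then `Y∘proj = 0`.  Proof: `Y∘proj` vanishes on the plane `x₀ − 2x₁ + x₂ = 0` (which projects onto the line), so it is
ODD under the reflection `ρ` in that plane (`eval_reflect₂_eq_neg`); but `proj ∘ ρ = (p ↦ (−p₂,−p₁,−p₀)) ∘ proj`, so it is also EVEN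
under `ρ`; hence it is zero.  Defs-free (the projection is any matrix with the stated action), so that the by-name stub only adds glue.

HONEST LABEL: a lemma; `:146`, ⟨23035⟩, ⟨23125⟩ OPEN; the Yang–Mills mass gap is NOT proved.
-/

noncomputable section

open MvPolynomial
open scoped BigOperators
open Literature.Algebra.Polynomial
open Summit.QuantumFields.YangMills.Theorems.F4SubCurvatureDoorSchwarzReflection (laplacian3)
open Summit.QuantumFields.YangMills.Theorems.F4SubCurvatureDoorSchwarzReflectionTwo (eval_reflect₂_eq_neg)

namespace Summit.QuantumFields.YangMills.Theorems.F4SubCurvatureDoorTrigonalProjUniqueness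

/-- **Uniqueness on the trigonal plane.**  See the module docstring. [TrigonalInjectivity.md §1 (1); folklore] -/
theorem bind₁_proj_eq_zero (Pm : Matrix (Fin 3) (Fin 3) ℝ)
    (hPm : ∀ q : Fin 3 → ℝ, Pm.mulVec q = fun i => q i - (q 0 + q 1 + q 2) / 3)
    (Y : MvPolynomial (Fin 3) ℝ) (hh : laplacian3 (bind₁ (linSubst Pm) Y) = 0)
    (hsym : ∀ p : Fin 3 → ℝ, p 0 + p 1 + p 2 = 0 → eval ![-p 2, -p 1, -p 0] Y = eval p Y)
    (hline : ∀ t : ℝ, eval ![t, 0, -t] Y = 0) : bind₁ (linSubst Pm) Y = 0 := by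
  set Z := bind₁ (linSubst Pm) Y with hZ
  -- (i) `Z` vanishes on the plane `x₀ − 2x₁ + x₂ = 0`, which projects onto the line `ℝ(1,0,−1)`
  have hvan : ∀ x : Fin 3 → ℝ, x 0 - 2 * x 1 + x 2 = 0 → eval x Z = 0 := by
    intro x hx
    rw [hZ, eval_bind₁_linSubst, hPm]
    have hx' : (fun i => x i - (x 0 + x 1 + x 2) / 3) = ![(x 0 - x 2) / 2, 0, -((x 0 - x 2) / 2)] := by
      funext i
      fin_cases i <;> simp <;> linarith
    rw [hx']
    exact hline _
  -- (ii) hence `Z` is odd under the reflection `ρ` in that plane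
  have hodd := eval_reflect₂_eq_neg Z hh hvan
  -- (iii) `Z` is even under `ρ`: `proj ∘ ρ = (p ↦ (−p₂,−p₁,−p₀)) ∘ proj`
  have heven : ∀ x : Fin 3 → ℝ,
      eval (fun i => x i - (x 0 - 2 * x 1 + x 2) / 3 * (![1, -2, 1] : Fin 3 → ℝ) i) Z = eval x Z := by
    intro x
    rw [hZ, eval_bind₁_linSubst, eval_bind₁_linSubst, hPm, hPm]
    set p : Fin 3 → ℝ := fun i => x i - (x 0 + x 1 + x 2) / 3 with hp
    have hplane : p 0 + p 1 + p 2 = 0 := by simp only [hp]; ring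
    have hkey : (fun i => (x i - (x 0 - 2 * x 1 + x 2) / 3 * (![1, -2, 1] : Fin 3 → ℝ) i) -
        ((x 0 - (x 0 - 2 * x 1 + x 2) / 3 * (![1, -2, 1] : Fin 3 → ℝ) 0) +
         (x 1 - (x 0 - 2 * x 1 + x 2) / 3 * (![1, -2, 1] : Fin 3 → ℝ) 1) +
         (x 2 - (x 0 - 2 * x 1 + x 2) / 3 * (![1, -2, 1] : Fin 3 → ℝ) 2)) / 3) = ![-p 2, -p 1, -p 0] := by
      funext i
      fin_cases i <;> simp [hp] <;> ring
    rw [hkey, hsym p hplane]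
  -- (iv) odd and even ⇒ zero
  refine MvPolynomial.funext fun x => ?_
  have h1 := hodd x
  rw [heven x] at h1
  rw [map_zero]
  linarith

end Summit.QuantumFields.YangMills.Theorems.F4SubCurvatureDoorTrigonalProjUniqueness

end
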